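import Literature.Combinatorics.Designs.LegendrePairs.TwoCirculantCore
import Literature.Combinatorics.Designs.GoethalsSeidelArray

/-!
# Legendre pairs over a finite abelian group and the two-core plug-in with group-developed cores

[Đoković–Kotsireas, arXiv:1801.07627 (2018), §9.3] (`DjokovicKotsireas2018`) and [Arasu–Bulutoglu–Hollon, J. Combin.
Des. 2020 = arXiv:2004.05608, Definition 5, Theorem 2] (`ArasuBulutogluHollon2020`): for a finite abelian group `G` of
(odd) order `v`, a *Legendre pair over `G`* is a pair `a, b : G → {±1}` with `PAF_a(s) + PAF_b(s) = -2` for every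
`s ≠ 0`, `PAF_a(s) = Σ_h a(h) a(h+s)` — equivalently a `2-{v; (v-1)/2, (v-1)/2; (v-3)/2}` supplementary difference
family in `G`; for `G = ZMod v` this is the (generalised) Legendre pair of Fletcher–Gysin–Seberry (the tree's
`LegendrePair`, `legendrePairOn_iff`).  The Fletcher–Gysin–Seberry bordered array with the two `G`-DEVELOPED
(type-1, "multicirculant") cores `A x y = a (x - y)`, `B x y = b (x - y)`,

  `H = [[-1, -1,  e,   e ],
        [-1,  1,  e,  -e ],
        [ eᵀ, eᵀ, A,   B ],
        [ eᵀ,-eᵀ, Bᵀ, -Aᵀ]]`,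

is a Hadamard matrix of order `2v + 2` for ANY finite abelian `G` ("all these facts remain valid over arbitrary finite
abelian groups", DK 2018 §9.3, with two printed Legendre pairs in the non-cyclic group `Z₅ × Z₅` giving order 52; ABH 2020
Thm 2): the verification uses only that `G`-developed matrices of an abelian group commute with each other and with their
transposes and have constant line sums.  This file is the tree's `TwoCirculantCore.lean` with `ZMod n` replaced by `G`:
`rowsum_sq_on` (row sums are `±1`), `twoCoreOn_gram` / `twoCoreOn_mul_transpose` (`H Hᵀ = (2v+2) I`), `twoCoreOn_pm`,
`twoCoreOn_isHadamard`, `exists_hadamard_of_legendrePairOn`.  Used by the order-668 census for the non-cyclic group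
`(ZMod 3 × ZMod 3) × ZMod 37` of order 333 (cell pub-namedobj, target H).  Our formalisation of the published
construction.  No `sorry`, no new axioms.
-/

open Matrix BigOperators Finset

namespace Literature.Combinatorics.Designs.LegendrePairs

open Literature.Combinatorics.Designs.GoethalsSeidel (IsHadamardMatrix)

variable {G : Type*} [AddCommGroup G] [Fintype G]

/-! ### definitions over a finite abelian group -/

/-- periodic autocorrelation over a finite abelian group: `PAF_c(s) = Σ_i c(i) c(i+s)`.
[cite: ArasuBulutogluHollon2020, Definition 2 (periodic autocorrelation of a G-array)] -/
def PAFOn (c : G → ℤ) (s : G) : ℤ := ∑ i, c i * c (i + s)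

/-- the `G`-array is `±1`-valued. [cite: ArasuBulutogluHollon2020, Definition 5 ({-1,1} G-arrays)] -/
def IsPMOn (c : G → ℤ) : Prop := ∀ i, c i = 1 ∨ c i = -1

/-- `(a, b)` is a Legendre pair over the finite abelian group `G`: two `±1` arrays with `PAF_a(s) + PAF_b(s) = -2` for all
`s ≠ 0` (row sums not normalised here; they are `±1` by `rowsum_sq_on`).
[cite: DjokovicKotsireas2018, §9.3 (Legendre pairs, α = -2); ArasuBulutogluHollon2020, Definition 5] -/
def LegendrePairOn (a b : G → ℤ) : Prop :=
  IsPMOn a ∧ IsPMOn b ∧ ∀ s : G, s ≠ 0 → PAFOn a s + PAFOn b s = -2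

/-- over `ZMod n` the group notion is literally the tree's `LegendrePair`. [cite: ArasuBulutogluHollon2020, §1.3 (Legendre Z_n-array pairs = Legendre pairs)] -/
theorem legendrePairOn_iff {n : ℕ} [NeZero n] (a b : ZMod n → ℤ) : LegendrePairOn a b ↔ LegendrePair a b := Iff.rfl

/-! ### row sums -/

/-- `(Σ_i c_i)^2 = Σ_s PAF_c(s)` (principal character). [cite: ArasuBulutogluHollon2020, eq. (a2b2)] -/
lemma sq_rowsum_on (c : G → ℤ) : (∑ i, c i) ^ 2 = ∑ s, PAFOn c s := by
  unfold PAFOn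
  have h : ∀ i : G, ∑ s, c i * c (i + s) = ∑ j, c i * c j := fun i => by
    have := Equiv.sum_comp (Equiv.addLeft i) (fun j => c i * c j)
    simpa only [Equiv.coe_addLeft] using this
  calc (∑ i, c i) ^ 2 = ∑ i, ∑ j, c i * c j := by rw [sq, Finset.sum_mul_sum]
    _ = ∑ i, ∑ s, c i * c (i + s) := Finset.sum_congr rfl fun i _ => (h i).symm
    _ = ∑ s, ∑ i, c i * c (i + s) := Finset.sum_comm

/-- `PAF_c(0) = |G|` for a `±1` array (the trivial autocorrelation). [cite: ArasuBulutogluHollon2020, §1.1 eq. (EqnACF) (P(1) = n for a {-1,1} G-array)] -/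
lemma pafOn_zero (c : G → ℤ) (hc : IsPMOn c) : PAFOn c 0 = Fintype.card G := by
  unfold PAFOn
  have : ∀ i, c i * c (i + 0) = 1 := fun i => by
    rw [add_zero]; rcases hc i with h | h <;> rw [h] <;> norm_num
  rw [Finset.sum_congr rfl fun i _ => this i]
  simp

/-! ### the bordered matrix with two `G`-developed cores -/

/-- index type of the bordered two-core matrix of order `2|G| + 2`. [cite: DjokovicKotsireas2018, §9.3 (array H_s)] -/
abbrev CoreIdxOn (G : Type*) : Type _ := (Unit ⊕ Unit) ⊕ (G ⊕ G)

/-- `[[-1,-1,e,e],[-1,1,e,-e],[eᵀ,eᵀ,A,B],[eᵀ,-eᵀ,Bᵀ,-Aᵀ]]` with `G`-developed cores `A x y = a (x - y)`,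
`B x y = b (x - y)`. [cite: DjokovicKotsireas2018, §9.3 (array H_s); ArasuBulutogluHollon2020, Theorem 2 (H_sym)] -/
def twoCoreOn (a b : G → ℤ) : Matrix (CoreIdxOn G) (CoreIdxOn G) ℤ := Matrix.of fun x y =>
  match x, y with
  | Sum.inl (Sum.inl _), Sum.inl (Sum.inl _) => -1
  | Sum.inl (Sum.inl _), Sum.inl (Sum.inr _) => -1
  | Sum.inl (Sum.inl _), Sum.inr (Sum.inl _) => 1
  | Sum.inl (Sum.inl _), Sum.inr (Sum.inr _) => 1
  | Sum.inl (Sum.inr _), Sum.inl (Sum.inl _) => -1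
  | Sum.inl (Sum.inr _), Sum.inl (Sum.inr _) => 1
  | Sum.inl (Sum.inr _), Sum.inr (Sum.inl _) => 1
  | Sum.inl (Sum.inr _), Sum.inr (Sum.inr _) => -1
  | Sum.inr (Sum.inl _), Sum.inl (Sum.inl _) => 1
  | Sum.inr (Sum.inl _), Sum.inl (Sum.inr _) => 1
  | Sum.inr (Sum.inl i), Sum.inr (Sum.inl j) => a (i - j)
  | Sum.inr (Sum.inl i), Sum.inr (Sum.inr j) => b (i - j)
  | Sum.inr (Sum.inr _), Sum.inl (Sum.inl _) => 1
  | Sum.inr (Sum.inr _), Sum.inl (Sum.inr _) => -1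
  | Sum.inr (Sum.inr i), Sum.inr (Sum.inl j) => b (j - i)
  | Sum.inr (Sum.inr i), Sum.inr (Sum.inr j) => -a (j - i)

/-! ### reindexing identities over `G` (abelian: developed matrices commute and are normal) -/

/-- row sums of a `G`-developed matrix are the array sum. [folklore] -/
private lemma sum_sub_left_on (x : G → ℤ) (k : G) : ∑ c, x (k - c) = ∑ c, x c :=
  Fintype.sum_equiv (Equiv.subLeft k) _ _ (fun _ => rfl)

/-- column sums of a `G`-developed matrix are the array sum. [folklore] -/
private lemma sum_sub_right_on (x : G → ℤ) (k : G) : ∑ c, x (c - k) = ∑ c, x c :=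
  Fintype.sum_equiv (Equiv.subRight k) _ _ (fun _ => rfl)

/-- `(A Aᵀ) i k = PAF_a (k - i)`. [folklore] -/
private lemma sum_mul_sub_left_on (x : G → ℤ) (i k : G) :
    ∑ c, x (i - c) * x (k - c) = PAFOn x (k - i) := by
  unfold PAFOn
  refine Fintype.sum_equiv (Equiv.subLeft i) _ _ (fun c => ?_)
  simp only [Equiv.subLeft_apply]
  congr 1; congr 1; abel

/-- `(Aᵀ A) i k = PAF_a (k - i)` (needs `G` abelian). [folklore] -/
private lemma sum_mul_sub_right_on (x : G → ℤ) (i k : G) :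
    ∑ c, x (c - i) * x (c - k) = PAFOn x (k - i) := by
  unfold PAFOn
  rw [show (∑ c, x (c - i) * x (c - k)) = ∑ c, x (c - k) * x (c - i) from
    Finset.sum_congr rfl (fun c _ => mul_comm _ _)]
  refine Fintype.sum_equiv (Equiv.subRight k) _ _ (fun c => ?_)
  simp only [Equiv.subRight_apply]
  congr 1; congr 1; abel

/-- `A B = B A` in convolution form (needs `G` abelian). [folklore] -/
private lemma conv_comm_on (x y : G → ℤ) (i k : G) :
    ∑ c, x (i - c) * y (c - k) = ∑ c, y (i - c) * x (c - k) := by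
  refine Fintype.sum_equiv (Equiv.subLeft (i + k)) _ _ (fun c => ?_)
  simp only [Equiv.subLeft_apply]
  rw [mul_comm]
  congr 1 <;> (congr 1; abel)

/-- `Bᵀ A = Aᵀ B`-type symmetry (needs `G` abelian). [folklore] -/
private lemma conv_comm_on' (x y : G → ℤ) (i k : G) :
    ∑ c, x (c - i) * y (k - c) = ∑ c, y (c - i) * x (k - c) := by
  refine Fintype.sum_equiv (Equiv.subLeft (i + k)) _ _ (fun c => ?_)
  simp only [Equiv.subLeft_apply]
  rw [mul_comm]
  congr 1 <;> (congr 1; abel)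

/-! ### the Gram identity -/

variable [DecidableEq G]

/-- the row sums of a Legendre pair over `G` satisfy `(Σa)^2 + (Σb)^2 = 2` (so both are `±1` and `|G|` is odd).
[cite: ArasuBulutogluHollon2020, eq. (a2b2)] -/
lemma rowsum_sq_on (a b : G → ℤ) (h : LegendrePairOn a b) :
    (∑ i, a i) ^ 2 + (∑ i, b i) ^ 2 = 2 := by
  rw [sq_rowsum_on, sq_rowsum_on, ← Finset.sum_add_distrib]
  have key : ∀ s : G, PAFOn a s + PAFOn b s = (if s = 0 then 2 * (Fintype.card G : ℤ) + 2 else 0) + (-2) := by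
    intro s; split_ifs with hs
    · subst hs; rw [pafOn_zero a h.1, pafOn_zero b h.2.1]; ring
    · rw [h.2.2 s hs]; ring
  rw [Finset.sum_congr rfl (fun s _ => key s), Finset.sum_add_distrib, Finset.sum_ite_eq',
    Finset.sum_const, Finset.card_univ]
  simp only [Finset.mem_univ, if_true]
  ring


/-- the Legendre condition as used below: `PAF_a(k-i) + PAF_b(k-i)` is `2|G|` on the diagonal and `-2` off it.
[cite: DjokovicKotsireas2018, §9.3 (PAF-constants α₀ = 2v, α = -2)] -/
lemma pafOn_add_pafOn (a b : G → ℤ) (h : LegendrePairOn a b) (i k : G) :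
    PAFOn a (k - i) + PAFOn b (k - i) = if i = k then 2 * (Fintype.card G : ℤ) else -2 := by
  obtain ⟨ha, hb, hL⟩ := h
  split_ifs with hik
  · subst hik; rw [sub_self, pafOn_zero a ha, pafOn_zero b hb]; ring
  · exact hL _ (sub_ne_zero.mpr (Ne.symm hik))

/-- **Two `G`-developed cores: `H Hᵀ = (2|G| + 2) I`** for a Legendre pair over `G` with row sums `+1`.
[cite: DjokovicKotsireas2018, §9.3 (H_s is a Hadamard matrix of order 2v+2, any finite abelian group); ArasuBulutogluHollon2020, Theorem 2] -/
theorem twoCoreOn_gram (a b : G → ℤ) (h : LegendrePairOn a b) (ha1 : ∑ i, a i = 1) (hb1 : ∑ i, b i = 1)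
    (x y : CoreIdxOn G) :
    ∑ z, twoCoreOn a b x z * twoCoreOn a b y z = if x = y then 2 * (Fintype.card G : ℤ) + 2 else 0 := by
  have hP := pafOn_add_pafOn a b h
  rcases x with ⟨⟨⟩ | ⟨⟩⟩ | ⟨i | i⟩ <;> rcases y with ⟨⟨⟩ | ⟨⟩⟩ | ⟨k | k⟩ <;>
    simp only [twoCoreOn, Matrix.of_apply, Fintype.sum_sum_type, Finset.sum_const, Finset.card_univ,
      Fintype.card_unique, one_smul, mul_one, mul_neg, neg_mul, neg_neg, one_mul,
      Finset.sum_neg_distrib, sum_sub_left_on, sum_sub_right_on, sum_mul_sub_left_on, sum_mul_sub_right_on, ha1, hb1,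
      Sum.inl.injEq, Sum.inr.injEq, reduceCtorEq, if_true, if_false, nsmul_eq_mul] <;>
    first
      | (rw [add_assoc, hP i k]; split_ifs <;> ring)
      | (rw [add_assoc, add_comm (PAFOn b _) (PAFOn a _), hP i k]; split_ifs <;> ring)
      | (rw [conv_comm_on a b i k]; ring)
      | (rw [conv_comm_on' b a i k]; ring)
      | ring

/-- matrix form: `H Hᵀ = (2|G| + 2)·I`. [cite: DjokovicKotsireas2018, §9.3; ArasuBulutogluHollon2020, Theorem 2] -/
theorem twoCoreOn_mul_transpose (a b : G → ℤ) (h : LegendrePairOn a b) (ha1 : ∑ i, a i = 1)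
    (hb1 : ∑ i, b i = 1) :
    twoCoreOn a b * (twoCoreOn a b)ᵀ =
      (2 * (Fintype.card G : ℤ) + 2) • (1 : Matrix (CoreIdxOn G) (CoreIdxOn G) ℤ) := by
  ext x y
  rw [Matrix.mul_apply]
  simp only [Matrix.transpose_apply, Matrix.smul_apply, Matrix.one_apply, smul_eq_mul, mul_ite, mul_one, mul_zero]
  exact twoCoreOn_gram a b h ha1 hb1 x y

omit [Fintype G] [DecidableEq G] in
/-- the entries are `±1` when `a, b` are. [cite: ArasuBulutogluHollon2020, Theorem 2] -/
theorem twoCoreOn_pm (a b : G → ℤ) (ha : IsPMOn a) (hb : IsPMOn b) (x y : CoreIdxOn G) :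
    twoCoreOn a b x y = 1 ∨ twoCoreOn a b x y = -1 := by
  have hneg : ∀ x : G → ℤ, IsPMOn x → ∀ t, -x t = 1 ∨ -x t = -1 := fun x hx t => by
    rcases hx t with h | h
    · right; rw [h]
    · left; rw [h]; norm_num
  rcases x with ⟨⟨⟩ | ⟨⟩⟩ | ⟨i | i⟩ <;> rcases y with ⟨⟨⟩ | ⟨⟩⟩ | ⟨k | k⟩ <;>
    simp only [twoCoreOn, Matrix.of_apply] <;>
    first | trivial | exact ha _ | exact hb _ | exact hneg a ha _

omit [AddCommGroup G] [DecidableEq G] in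
/-- the order of the bordered two-core matrix is `2|G| + 2`. [cite: DjokovicKotsireas2018, §9.3] -/
lemma card_coreIdxOn : Fintype.card (CoreIdxOn G) = 2 * Fintype.card G + 2 := by
  simp [CoreIdxOn, Fintype.card_sum]; ring

/-- **Hadamard matrix from a Legendre pair over a finite abelian group (row sums `+1`).**
[cite: DjokovicKotsireas2018, §9.3; ArasuBulutogluHollon2020, Theorem 2] -/
theorem twoCoreOn_isHadamard (a b : G → ℤ) (h : LegendrePairOn a b) (ha1 : ∑ i, a i = 1) (hb1 : ∑ i, b i = 1) :
    IsHadamardMatrix (twoCoreOn a b) := by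
  refine ⟨twoCoreOn_pm a b h.1 h.2.1, ?_⟩
  rw [twoCoreOn_mul_transpose a b h ha1 hb1, card_coreIdxOn]
  push_cast
  rfl

omit [DecidableEq G] in
/-- negating one array preserves the Legendre-pair property. [folklore] -/
private lemma legendrePairOn_neg_left (a b : G → ℤ) (h : LegendrePairOn a b) :
    LegendrePairOn (-a) b := by
  obtain ⟨ha, hb, hL⟩ := h
  refine ⟨fun i => ?_, hb, fun s hs => ?_⟩
  · rcases ha i with h | h <;> simp [h]
  · rw [← hL s hs]; unfold PAFOn; simp

omit [DecidableEq G] in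
/-- … and for the second array. [folklore] -/
private lemma legendrePairOn_neg_right (a b : G → ℤ) (h : LegendrePairOn a b) :
    LegendrePairOn a (-b) := by
  obtain ⟨ha, hb, hL⟩ := h
  refine ⟨ha, fun i => ?_, fun s hs => ?_⟩
  · rcases hb i with h | h <;> simp [h]
  · rw [← hL s hs]; unfold PAFOn; simp

/-- **Đoković–Kotsireas / Arasu–Bulutoglu–Hollon (after Fletcher–Gysin–Seberry).** A Legendre pair over ANY finite
abelian group `G` gives a Hadamard matrix of order `2|G| + 2` (normalise the row sums to `+1` — each is `±1` by
`rowsum_sq_on` — and take the bordered matrix with the two `G`-developed cores).  For `|G| = 333`, in particular for the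
non-cyclic `G = (ZMod 3 × ZMod 3) × ZMod 37`, the order is `668`.
[cite: DjokovicKotsireas2018, §9.3; ArasuBulutogluHollon2020, Theorem 2] -/
theorem exists_hadamard_of_legendrePairOn (a b : G → ℤ) (h : LegendrePairOn a b) :
    ∃ H : Matrix (CoreIdxOn G) (CoreIdxOn G) ℤ,
      IsHadamardMatrix H ∧ Fintype.card (CoreIdxOn G) = 2 * Fintype.card G + 2 := by
  -- normalise the row sum of `a`
  obtain ⟨a', ha', hab'⟩ : ∃ a' : G → ℤ, (∑ i, a' i) = 1 ∧ LegendrePairOn a' b := by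
    rcases pm_of_sq _ _ (rowsum_sq_on a b h) with h1 | h1
    · exact ⟨a, h1, h⟩
    · refine ⟨-a, ?_, legendrePairOn_neg_left a b h⟩
      simp only [Pi.neg_apply, Finset.sum_neg_distrib, h1, neg_neg]
  -- normalise the row sum of `b`
  obtain ⟨b', hb', hab⟩ : ∃ b' : G → ℤ, (∑ i, b' i) = 1 ∧ LegendrePairOn a' b' := by
    have hsq := rowsum_sq_on a' b hab'
    rcases pm_of_sq _ _ (by rw [add_comm]; exact hsq) with h1 | h1
    · exact ⟨b, h1, hab'⟩
    · refine ⟨-b, ?_, legendrePairOn_neg_right a' b hab'⟩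
      simp only [Pi.neg_apply, Finset.sum_neg_distrib, h1, neg_neg]
  exact ⟨twoCoreOn a' b', twoCoreOn_isHadamard a' b' hab ha' hb', card_coreIdxOn⟩

end Literature.Combinatorics.Designs.LegendrePairs
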